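import Literature.NumberTheory.EllipticCurves.Kato2004.BigImageDivisibilityCyclotomicThree
import Literature.NumberTheory.EllipticCurves.Kato2004.BigImageDivisibilityCyclotomicPrime
import HarnessLib

/-!
# Kato 2004 Thm. 17.4 (3) at `p = 3` over `ℚ(ζ₃)` (A99) — DERIVED from the odd-`p` reading (A118)
# `charIdeal_dvd_padicLFunction_cyclotomicThree_of_surjective`
#   ⟸ `charIdeal_dvd_padicLFunction_cyclotomicPrime_of_surjective`
# (NO named fact in this file; kernel consistency check between two transcriptions of one theorem)

HONEST FRAMING (cell `b2b-bsdres`, verbatim): the goal of the cell is to DELETE the COMBINATION-SHAPED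
residual classes for ALL analytic-rank ≤ 1 curves over ℚ from PUBLISHED theorems only; the
CONSTRUCTION-SHAPED classes are TYPED, not attempted; this is not "finishing BSD". This file adds no
assertion: it shows in the kernel that the `p = 3` special case of a reading-fact IS the special case.

Source: K. Kato, *`p`-adic Hodge theory and values of zeta functions of modular forms*, Astérisque
295 (2004) 117–290 [Kato2004], Theorem 17.4 (3) (p. 273; held copy `paper:doi-10-24033-ast-639`
p0158 L26–L27: "Assume `f` has good ordinary reduction at `λ` …"; (3) under the surjectivity of `ρ`)
via Thm. 12.5 (4) (p. 222) under (12.5.2), §17.13 (p. 279: "17.4 (3) … follows also from 17.11,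
12.5 (4)"), Thm. 16.2 (p. 269); the `K = ℚ(ζ_p)`-reading of all `p − 1` branches is given in full in the
two module docstrings.

The cell holds TWO transcriptions of this theorem over `K = ℚ(ζ_p)` for curves with surjective
`ρ_{E,p^∞}`: the `p = 3` reading `charIdeal_dvd_padicLFunction_cyclotomicThree_of_surjective`
(additive-p4 gen 5, p216633; registry A99, flag `Kato-17.4-p3-branch-split`: two branches
`L₃(E,ω⁰,T) · L₃(E,ω¹,T)`) and the odd-`p` reading
`charIdeal_dvd_padicLFunction_cyclotomicPrime_of_surjective` (additive-p4 gen 9, p228429; A118: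
all `p − 1` branches `∏_{i<p−1} B_i`, unit factor `u ϖ^{(p−1)/2} ϖ'^{(p−1)/2}`). The literature seat's
ruling C167 (ii) (2026-08-20) asks that reading VARIANTS be derived in the kernel rather than held as
separate debts. THIS FILE is that derivation for the pair (A99, A118): at `p = 3` the product over
`Finset.range 2` is `padicLFunctionBranch f α 0 · padicLFunctionMinusBranch f α 1`, the trivial branch
IS `padicLFunction f α` (`padicLFunctionBranch_zero`), `3 / 2 = 1`, and every other binder (globally
minimal `V`, `IsOrdinaryAt V 3`, `∀ n, Surj(3ⁿ)`, `IsCyclotomicExtension {3} ℚ K`, the `K`-model `V'`,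
`κ` cyclotomic with generator `γ`, `χ₃(γ)·ζ = cyclotomicGenerator 3`, `IsNewformOf V f`, the dual
datum `D`, the periods `ϖ, ϖ'`) is literally the `p = 3` instance of the general binder. ONE theorem,
no `def`, no new assertion (debt 0); once its consumers are migrated the referee may retire A99 as an
independent reading.
-/

set_option autoImplicit false

noncomputable section

open scoped Classical MatrixGroups ModularForm

open CongruenceSubgroup WeierstrassCurve Literature.NumberTheory.EllipticCurves
  Literature.NumberTheory.EllipticCurves.ModularForms
  Literature.NumberTheory.GaloisRepresentations

namespace Literature.NumberTheory.EllipticCurves.Kato2004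

/-- **A99 from A118.** Kato 2004 Thm. 17.4 (3) (Astérisque 295, p. 273: for `f` good ordinary at
`p` with `ρ_{f,λ}` surjective, `char X(f) ⊂ Λ` divides the `p`-adic `L`-function in
`Λ = ℤ_p⟦Gal(ℚ(ζ_{p^∞})/ℚ)⟧`), read over `K = ℚ(ζ₃)` with the two tame branches — the `p = 3`
reading `charIdeal_dvd_padicLFunction_cyclotomicThree_of_surjective` — follows from the odd-`p`
reading `charIdeal_dvd_padicLFunction_cyclotomicPrime_of_surjective` specialised at `p = 3`:
`∏_{i<2} B_i = padicLFunctionBranch f α 0 · padicLFunctionMinusBranch f α 1`,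
`padicLFunctionBranch f α 0 = padicLFunction f α` (`padicLFunctionBranch_zero`), `ϖ^{3/2} = ϖ`.
Kernel consistency check between two transcriptions of the same printed theorem; no new assertion.
[cite: Kato2004, Thm. 17.4 (3) (p. 273), Thm. 12.5 (4) (p. 222), §17.13 (p. 279), Thm. 16.2 (p. 269)]
[cite: MazurTateTeitelbaum1986Invent, §I.13] -/
theorem charIdeal_dvd_padicLFunction_cyclotomicThree_of_surjective_of_cyclotomicPrime
    (h : charIdeal_dvd_padicLFunction_cyclotomicPrime_of_surjective) :
    charIdeal_dvd_padicLFunction_cyclotomicThree_of_surjective := by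
  intro V _ _ K _ _ _ V' _ κ γ N _ f hord hsurj hC hcyc hγ hζ hf D ϖ ϖ' hϖ hϖ'
  obtain ⟨htors, g, hg, u, hu⟩ :=
    h 3 V K V' (by decide) hord hsurj hC hcyc hγ hζ hf D ϖ ϖ' hϖ hϖ'
  refine ⟨htors, g, hg, u, ?_⟩
  rw [hu]
  have h2 : (3 : ℕ) / 2 = 1 := rfl
  have h1 : (3 : ℕ) - 1 = 2 := rfl
  have h0 : Even (0 : ℕ) := ⟨0, rfl⟩
  simp only [h2, h1, pow_one, Finset.prod_range_succ, Finset.prod_range_zero, one_mul, h0,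
    if_true, Nat.not_even_one, if_false, padicLFunctionBranch_zero]

end Literature.NumberTheory.EllipticCurves.Kato2004

end
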